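import Mathlib
import Summits.Ventures.PercRepro2.CoinCoreGate
import Summits.Ventures.PercRepro2.CoinOrTailKDefs
import Summits.Ventures.PercRepro2.CoinOrTailKSums
import Summits.Ventures.PercRepro2.CoinOrTailKCore
import Summits.Ventures.PercRepro2.CoinKSureTailSums
import Summits.Ventures.PercRepro2.CoinChainTower
import Summits.Ventures.PercRepro2.CoinTowerClose
import Summits.Ventures.PercRepro2.CoinTowerFunnel

/-!
# The funnel with RANDOM coins above the marker vertex (blind cell PercRepro2, night-2 g18;
proofs/NIGHT2-DARC.md §58.11)

`darc_of_towerFunnel` (§58.10) took sure coins everywhere.  Here the upper tower and the free-arc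
vertex `a` carry ANY coins: the entered parts of the `R`-law and of the gate at `a`
(`rValKa`, `gValKa` of §49) are transported through the upper tower by `towerVal` (linear in the
head: `towerVal_linear`) and through the lower tower by the sure-coin closure; the marker
`1[v ∈ S⁺]` is `1` wherever the entered parts are nonzero (the funnel), and the WEIGHTED nested
lemma **`nested_weighted_nonneg`** (`G' = G − R₁ + G₁`, `x·R₁ = R₁`, `x·G₁ = G₁` ⟹
`T = (Λ − Λ₁)·[M₁₁·(Λ − Λ₂) + Λ₂²] ≥ 0`) closes: **`darc_of_towerFunnel_coins`** — both markers
`(v, a)`, sure coins below and at `v`, ANY coins above, ANY core.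
-/

namespace Summit.Ventures.PercRepro2.Coin

open Classical

section TowerValMore

variable {V : Type*} {E : Type*} [DecidableEq V] {R : Type*} [Field R] [LinearOrder R]
  [IsStrictOrderedRing R]

omit [LinearOrder R] [IsStrictOrderedRing R] in
/-- `towerVal` is linear in the head. -/
lemma towerVal_linear (pr : E → R) : ∀ (L : List (Finset V × (V → E) × V))
    (F F₁ F₂ : Finset V → R) (W : Finset V),
    towerVal pr L (fun X => F X - F₁ X + F₂ X) W =
      towerVal pr L F W - towerVal pr L F₁ W + towerVal pr L F₂ W
  | [], _, _, _, _ => rfl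
  | x :: rest, F, F₁, F₂, W => by
      simp only [towerVal]
      have h : towerVal pr rest (fun X => F X - F₁ X + F₂ X) =
          fun X => towerVal pr rest F X - towerVal pr rest F₁ X + towerVal pr rest F₂ X :=
        funext fun X => towerVal_linear pr rest F F₁ F₂ X
      rw [h]
      unfold rValK
      ring

/-- `towerVal` of a nonnegative head is nonnegative. -/
lemma towerVal_nonneg (pr : E → R) (hp0 : ∀ e, 0 ≤ pr e) (hp1 : ∀ e, pr e ≤ 1) :
    ∀ (L : List (Finset V × (V → E) × V)) (F : Finset V → R), (∀ W, 0 ≤ F W) →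
      ∀ W, 0 ≤ towerVal pr L F W
  | [], _, hF, W => hF W
  | x :: rest, F, hF, W =>
      rValK_nonneg hp0 hp1 (towerVal_nonneg pr hp0 hp1 rest F hF) x.1 x.2.1 x.2.2 W

/-- The entered `R`-value is at most the `R`-value. -/
lemma rValKa_le_rValK (A : Finset V → R) (pr : E → R) (hp1 : ∀ e, pr e ≤ 1) (hA0 : ∀ W, 0 ≤ A W)
    (ent : Finset V) (c : V → E) (a : V) (W : Finset V) :
    rValKa A pr ent c a W ≤ rValK A pr ent c a W := by
  unfold rValKa rValK
  have := tailWtK_nonneg hp1 ent c W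
  have := hA0 W
  nlinarith

/-- The entered `R`-value is nonnegative. -/
lemma rValKa_nonneg (A : Finset V → R) (pr : E → R) (hp0 : ∀ e, 0 ≤ pr e) (hp1 : ∀ e, pr e ≤ 1)
    (hA0 : ∀ W, 0 ≤ A W) (ent : Finset V) (c : V → E) (a : V) (W : Finset V) :
    0 ≤ rValKa A pr ent c a W := by
  unfold rValKa
  have := tailWtK_le_one hp0 hp1 ent c W
  exact mul_nonneg (by linarith) (hA0 _)

/-- The entered gate value is nonnegative. -/
lemma gValKa_nonneg (A : Finset V → R) (pr : E → R) (hp0 : ∀ e, 0 ≤ pr e) (hp1 : ∀ e, pr e ≤ 1)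
    (hA0 : ∀ W, 0 ≤ A W) (ent : Finset V) (c : V → E) (a w : V) (W : Finset V) :
    0 ≤ gValKa A pr ent c a w W := by
  unfold gValKa
  have := tailWtK_le_one hp0 hp1 ent c W
  exact mul_nonneg (by linarith) (hA0 _)

omit [LinearOrder R] [IsStrictOrderedRing R] in
/-- The gate value is the `R`-value with the entered part exchanged. -/
lemma gValK_eq_rValK_sub_add (A : Finset V → R) (pr : E → R) (ent : Finset V) (c : V → E)
    (a w : V) (W : Finset V) :
    gValK A pr ent c a w W = rValK A pr ent c a W - rValKa A pr ent c a W + gValKa A pr ent c a w W := by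
  unfold gValK rValK rValKa gValKa
  ring

omit [LinearOrder R] [IsStrictOrderedRing R] in
/-- On a level missing every entry the entered `R`-value vanishes. -/
lemma rValKa_eq_zero_of_no_entry (A : Finset V → R) (pr : E → R) {ent : Finset V} (c : V → E)
    (a : V) {W : Finset V} (hW : ∀ r ∈ ent, r ∉ W) : rValKa A pr ent c a W = 0 := by
  unfold rValKa
  rw [tailWtK_eq_one_of_no_entry pr c hW]
  ring

omit [LinearOrder R] [IsStrictOrderedRing R] in
/-- On a level missing every entry the entered gate value vanishes. -/
lemma gValKa_eq_zero_of_no_entry (A : Finset V → R) (pr : E → R) {ent : Finset V} (c : V → E)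
    (a w : V) {W : Finset V} (hW : ∀ r ∈ ent, r ∉ W) : gValKa A pr ent c a w W = 0 := by
  unfold gValKa
  rw [tailWtK_eq_one_of_no_entry pr c hW]
  ring

end TowerValMore

section NestedWeighted

variable {V : Type*} {R : Type*} [Field R] [LinearOrder R] [IsStrictOrderedRing R]

/-- **The weighted nested-marker functional is nonnegative for ANY laws**: `R₁` the entered part
of the `R`-law `G`, `G₁` the entered part of the gate `G' = G − R₁ + G₁`, and a `{0,1}`-marker `x`
equal to `1` wherever the entered parts live ⟹ `T = (Λ − Λ₁)·[M₁₁·(Λ − Λ₂) + Λ₂²] ≥ 0`, where the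
second marker's sums are the entered parts. -/
theorem nested_weighted_nonneg (U : Finset V) (G G' R₁ G₁ x : Finset V → R)
    (hG : ∀ W, 0 ≤ G W) (hG₁ : ∀ W, 0 ≤ G₁ W)
    (hle : ∀ W, R₁ W ≤ G W) (hG' : ∀ W, G' W = G W - R₁ W + G₁ W)
    (hx01 : ∀ W, x W = 0 ∨ x W = 1)
    (hxR : ∀ W ∈ U.powerset, x W * R₁ W = R₁ W) (hxG : ∀ W ∈ U.powerset, x W * G₁ W = G₁ W) :
    0 ≤ (∑ W ∈ U.powerset, G W) ^ 2 * (∑ W ∈ U.powerset, G₁ W * x W)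
        - (∑ W ∈ U.powerset, G W) * (∑ W ∈ U.powerset, G W * x W) *
          (∑ W ∈ U.powerset, G₁ W)
        - (∑ W ∈ U.powerset, G W) * (∑ W ∈ U.powerset, R₁ W) *
          (∑ W ∈ U.powerset, G' W * x W)
        + (∑ W ∈ U.powerset, G W * x W) * (∑ W ∈ U.powerset, R₁ W) *
          (∑ W ∈ U.powerset, G' W) := by
  have eM₁₁ : ∑ W ∈ U.powerset, G₁ W * x W = ∑ W ∈ U.powerset, G₁ W :=
    Finset.sum_congr rfl fun W hW => by rw [mul_comm, hxG W hW]
  have eM₁ : ∑ W ∈ U.powerset, G' W * x W =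
      (∑ W ∈ U.powerset, G W * x W - ∑ W ∈ U.powerset, R₁ W) + ∑ W ∈ U.powerset, G₁ W := by
    rw [← Finset.sum_sub_distrib, ← Finset.sum_add_distrib]
    refine Finset.sum_congr rfl fun W hW => ?_
    rw [hG' W]
    have h1 := hxR W hW
    have h2 := hxG W hW
    linear_combination (-1 : R) * h1 + h2
  have eM : ∑ W ∈ U.powerset, G' W =
      (∑ W ∈ U.powerset, G W - ∑ W ∈ U.powerset, R₁ W) + ∑ W ∈ U.powerset, G₁ W := by
    rw [← Finset.sum_sub_distrib, ← Finset.sum_add_distrib]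
    exact Finset.sum_congr rfl fun W _ => hG' W
  rw [eM₁₁, eM₁, eM]
  have hx1 : ∀ W, x W ≤ 1 := fun W => by rcases hx01 W with h | h <;> simp [h]
  have hx0 : ∀ W, 0 ≤ x W := fun W => by rcases hx01 W with h | h <;> simp [h]
  have hΛ₁ : ∑ W ∈ U.powerset, G W * x W ≤ ∑ W ∈ U.powerset, G W :=
    Finset.sum_le_sum fun W _ => by
      calc G W * x W ≤ G W * 1 := mul_le_mul_of_nonneg_left (hx1 W) (hG W)
        _ = G W := mul_one _
  have hΛ₂ : ∑ W ∈ U.powerset, R₁ W ≤ ∑ W ∈ U.powerset, G W :=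
    Finset.sum_le_sum fun W _ => hle W
  have hM₁₁ : 0 ≤ ∑ W ∈ U.powerset, G₁ W := Finset.sum_nonneg fun W _ => hG₁ W
  have key : ∀ Λ Λ₁ Λ₂ M₁₁ : R,
      Λ ^ 2 * M₁₁ - Λ * Λ₁ * M₁₁ - Λ * Λ₂ * ((Λ₁ - Λ₂) + M₁₁) + Λ₁ * Λ₂ * ((Λ - Λ₂) + M₁₁) =
        (Λ - Λ₁) * (M₁₁ * (Λ - Λ₂) + Λ₂ ^ 2) := by intros; ring
  rw [key]
  exact mul_nonneg (sub_nonneg.2 hΛ₁)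
    (add_nonneg (mul_nonneg hM₁₁ (sub_nonneg.2 hΛ₂)) (sq_nonneg _))

end NestedWeighted


section TowerFunnelCoins

variable {V : Type*} {E : Type*} [Fintype V] [DecidableEq V] [Fintype E] [DecidableEq E]
  {R : Type*} [Field R] [LinearOrder R] [IsStrictOrderedRing R]
  {arcs : E → Finset (V × V)} {s : V} {U : Finset V} {ent entv : Finset V} {c cv : V → E}
  {a v w : V} {low up : List (Finset V × (V → E) × V)}

/-- **THEOREM (the funnel with ANY coins above the marker vertex, ANY core).** A SURE-coin OR-tower
`low` and a SURE-coin OR-vertex `v` of its core, an OR-tower `up` above `v` and an OR-vertex `a` on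
top with ANY coins, over a closed-in core `U` with NO log-supermodularity; every entry of the levels
above `v` and of `a` lies outside the lower tower core (every route into `a` passes through `v`);
`t, w ∉ insert a (towerCore (insert v (towerCore U low)) up)`, `t, w ≠ s` ⟹
`DARC pr arcs s {t} v a a w`. -/
theorem darc_of_towerFunnel_coins (pr : E → R) (hp : IsProbVec pr) (hS : SameEnds arcs)
    (hL : OrTower arcs s U low) (hsureL : ∀ x ∈ low, ∀ r ∈ x.1, pr (x.2.1 r) = 1)
    (hv : OrTailK arcs s (towerCore U low) entv cv v) (hsurev : ∀ r ∈ entv, pr (cv r) = 1)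
    (hup : OrTower arcs s (insert v (towerCore U low)) up)
    (h : OrTailK arcs s (towerCore (insert v (towerCore U low)) up) ent c a)
    (hcovL : ∀ x ∈ up, ∀ r ∈ x.1, r ∉ towerCore U low) (hcov : ∀ r ∈ ent, r ∉ towerCore U low)
    {t : V} (htC : t ∉ insert a (towerCore (insert v (towerCore U low)) up)) (hts : t ≠ s)
    (hws : w ≠ s) (hwC : w ∉ insert a (towerCore (insert v (towerCore U low)) up)) :
    DARC pr arcs s {t} v a a w := by
  have hC := h.closedInCoreU
  -- the lower tower with `v` on top, over `U`
  have hLv : OrTower arcs s U (low ++ [(entv, cv, v)]) :=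
    hL.append (OrTower.cons _ _ _ _ _ hv (OrTower.nil _))
  have hcoreLv : towerCore U (low ++ [(entv, cv, v)]) = insert v (towerCore U low) := by
    rw [towerCore_append]; rfl
  have hsureLv : ∀ x ∈ low ++ [(entv, cv, v)], ∀ r ∈ x.1, pr (x.2.1 r) = 1 := by
    intro x hx
    rcases List.mem_append.1 hx with hx | hx
    · exact hsureL x hx
    · rw [List.mem_singleton] at hx; subst hx; exact hsurev
  -- memberships
  have hvT : v ∈ towerCore (insert v (towerCore U low)) up :=
    subset_towerCore _ up (Finset.mem_insert_self _ _)
  have haC' : a ∉ towerCore (insert v (towerCore U low)) up := h.a_notin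
  have hva : v ≠ a := fun e => haC' (e ▸ hvT)
  have hvert := hup.vertex_notin
  have hvv : ∀ x ∈ up, v ≠ x.2.2 := fun x hx e => hvert x hx (e ▸ Finset.mem_insert_self _ _)
  have hvC : v ∈ insert a (towerCore (insert v (towerCore U low)) up) :=
    Finset.mem_insert_of_mem hvT
  have haC : a ∈ insert a (towerCore (insert v (towerCore U low)) up) := Finset.mem_insert_self _ _
  unfold DARC
  rw [hC.phiC_gate_eq pr hS htC hts hvC haC haC hws hwC]
  -- the marker functions and their invariances
  have hm1 : ∀ W : Finset V, (fun _ : Finset V => (1 : R)) (insert a W) = (fun _ => (1 : R)) W :=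
    fun _ => rfl
  have hm1L : ∀ x ∈ up, ∀ W : Finset V, (fun _ : Finset V => (1 : R)) (insert x.2.2 W) =
    (fun _ => (1 : R)) W := fun _ _ _ => rfl
  have hxa : ∀ W : Finset V, (fun W : Finset V => if v ∈ W then (1 : R) else 0) (insert a W) =
      (fun W : Finset V => if v ∈ W then (1 : R) else 0) W := by
    intro W; simp only [Finset.mem_insert, hva, false_or]
  have hxL : ∀ x ∈ up, ∀ W : Finset V,
      (fun W : Finset V => if v ∈ W then (1 : R) else 0) (insert x.2.2 W) =
      (fun W : Finset V => if v ∈ W then (1 : R) else 0) W := by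
    intro x hx W; simp only [Finset.mem_insert, hvv x hx, false_or]
  have hg0 : ∀ W : Finset V, a ∉ W → (fun W : Finset V => if a ∈ W then (1 : R) else 0) W = 0 :=
    by intro W hW; simp only [hW, if_false]
  have hg1 : ∀ W : Finset V, a ∉ W →
      (fun W : Finset V => if a ∈ W then (1 : R) else 0) (insert a W) = (fun _ => (1 : R)) W := by
    intro W _; simp only [Finset.mem_insert_self, if_true]
  have hq0 : ∀ W : Finset V, a ∉ W →
      (fun W : Finset V => (if v ∈ W then (1 : R) else 0) * (if a ∈ W then (1 : R) else 0)) W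
        = 0 := by intro W hW; simp only [hW, if_false, mul_zero]
  have hq1 : ∀ W : Finset V, a ∉ W →
      (fun W : Finset V => (if v ∈ W then (1 : R) else 0) * (if a ∈ W then (1 : R) else 0))
          (insert a W) =
        (fun W : Finset V => if v ∈ W then (1 : R) else 0) W := by
    intro W _
    simp only [Finset.mem_insert_self, if_true, mul_one, Finset.mem_insert, hva, false_or]
  -- the level reduction over `a`
  have eΛ := h.sum_R_eq pr t (fun _ => (1 : R)) hm1
  have eFa := h.sum_R_eq pr t (fun W => if v ∈ W then (1 : R) else 0) hxa
  have eFb := h.sum_R_eq_tail pr t (fun W => if a ∈ W then (1 : R) else 0) (fun _ => (1 : R))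
    hg0 hg1
  have eM := h.sum_G_eq (w := w) pr t (fun _ => (1 : R)) hm1
  have eX := h.sum_G_eq (w := w) pr t (fun W => if v ∈ W then (1 : R) else 0) hxa
  have eY := h.sum_G_eq_tail (w := w) pr t (fun W => if a ∈ W then (1 : R) else 0)
    (fun _ => (1 : R)) hg0 hg1
  have eXY := h.sum_G_eq_tail (w := w) pr t
    (fun W => (if v ∈ W then (1 : R) else 0) * (if a ∈ W then (1 : R) else 0))
    (fun W => if v ∈ W then (1 : R) else 0) hq0 hq1
  simp only [mul_one] at eΛ eFb eM eY
  rw [eΛ, eFa, eFb, eM, eX, eY, eXY]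
  set A : Finset V → R := fun X =>
    prob pr (coreAvoidEvent arcs s t (insert a (towerCore (insert v (towerCore U low)) up)) X)
    with hAdef
  obtain ⟨hA0, -, -⟩ :=
    OrTailU.head_props (U := towerCore (insert v (towerCore U low)) up) (a := a) pr hp hS t
  have hp0 := hp.nonneg; have hp1 := hp.le_one
  set FR : Finset V → R := rValK A pr ent c a with hFR
  set FG : Finset V → R := gValK A pr ent c a w with hFG
  set FRa : Finset V → R := rValKa A pr ent c a with hFRa
  set FGa : Finset V → R := gValKa A pr ent c a w with hFGa
  -- the upper tower
  have tΛ := hup.sum_tower pr FR (fun _ => (1 : R)) hm1L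
  have tFa := hup.sum_tower pr FR (fun W => if v ∈ W then (1 : R) else 0) hxL
  have tFb := hup.sum_tower pr FRa (fun _ => (1 : R)) hm1L
  have tM := hup.sum_tower pr FG (fun _ => (1 : R)) hm1L
  have tX := hup.sum_tower pr FG (fun W => if v ∈ W then (1 : R) else 0) hxL
  have tY := hup.sum_tower pr FGa (fun _ => (1 : R)) hm1L
  have tXY := hup.sum_tower pr FGa (fun W => if v ∈ W then (1 : R) else 0) hxL
  simp only [mul_one] at tΛ tFb tM tY
  rw [tΛ, tFa, tFb, tM, tX, tY, tXY, ← hcoreLv]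
  set TR : Finset V → R := towerVal pr up FR with hTR
  set TG : Finset V → R := towerVal pr up FG with hTG
  set TRa : Finset V → R := towerVal pr up FRa with hTRa
  set TGa : Finset V → R := towerVal pr up FGa with hTGa
  -- the lower tower with `v`: the closure
  have assoc : ∀ (C : Finset V) (F m : Finset V → R),
      (∑ X ∈ C.powerset, prob pr (coreLevel arcs s C X) * F X * m X) =
        ∑ X ∈ C.powerset, prob pr (coreLevel arcs s C X) * (F X * m X) :=
    fun C F m => Finset.sum_congr rfl fun X _ => mul_assoc _ _ _
  rw [assoc _ TR (fun X => if v ∈ X then (1 : R) else 0),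
    assoc _ TG (fun X => if v ∈ X then (1 : R) else 0),
    assoc _ TGa (fun X => if v ∈ X then (1 : R) else 0)]
  have dΛ := hLv.sum_close pr hsureLv TR
  have dFa := hLv.sum_close pr hsureLv (fun X => TR X * (if v ∈ X then (1 : R) else 0))
  have dFb := hLv.sum_close pr hsureLv TRa
  have dM := hLv.sum_close pr hsureLv TG
  have dX := hLv.sum_close pr hsureLv (fun X => TG X * (if v ∈ X then (1 : R) else 0))
  have dY := hLv.sum_close pr hsureLv TGa
  have dXY := hLv.sum_close pr hsureLv (fun X => TGa X * (if v ∈ X then (1 : R) else 0))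
  beta_reduce at dFa dX dXY
  rw [dΛ, dFa, dFb, dM, dX, dY, dXY]
  have assoc' : ∀ (F m : Finset V → R),
      (∑ W ∈ U.powerset, prob pr (coreLevel arcs s U W) *
          (F (clSet (low ++ [(entv, cv, v)]) W) * m (clSet (low ++ [(entv, cv, v)]) W))) =
        ∑ W ∈ U.powerset, prob pr (coreLevel arcs s U W) * F (clSet (low ++ [(entv, cv, v)]) W) *
          m (clSet (low ++ [(entv, cv, v)]) W) :=
    fun F m => Finset.sum_congr rfl fun W _ => (mul_assoc _ _ _).symm
  rw [assoc' TR (fun X => if v ∈ X then (1 : R) else 0),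
    assoc' TG (fun X => if v ∈ X then (1 : R) else 0),
    assoc' TGa (fun X => if v ∈ X then (1 : R) else 0)]
  -- the weighted nested functional
  have hν0 : ∀ W, 0 ≤ prob pr (coreLevel arcs s U W) := fun W => prob_nonneg hp _
  have hFR0 : ∀ W, 0 ≤ FR W := fun W => rValK_nonneg hp0 hp1 hA0 ent c a W
  have hFGa0 : ∀ W, 0 ≤ FGa W := fun W => gValKa_nonneg A pr hp0 hp1 hA0 ent c a w W
  have hTR0 : ∀ W, 0 ≤ TR W := towerVal_nonneg pr hp0 hp1 up FR hFR0
  have hTGa0 : ∀ W, 0 ≤ TGa W := towerVal_nonneg pr hp0 hp1 up FGa hFGa0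
  have hTRale : ∀ W, TRa W ≤ TR W :=
    towerVal_head_le pr hp0 hp1 up (fun W => rValKa_le_rValK A pr hp1 hA0 ent c a W)
  have hTGeq : ∀ W, TG W = TR W - TRa W + TGa W := by
    intro W
    have hFGeq : FG = fun X => FR X - FRa X + FGa X :=
      funext fun X => gValK_eq_rValK_sub_add A pr ent c a w X
    simp only [hTG, hTR, hTRa, hTGa]
    rw [hFGeq]
    exact towerVal_linear pr up FR FRa FGa W
  have hcl : ∀ W ⊆ U, clSet (low ++ [(entv, cv, v)]) W ⊆ insert v (towerCore U low) :=
    fun W hW => hcoreLv ▸ clSet_subset_towerCore (low ++ [(entv, cv, v)]) U W hW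
  have hzero : ∀ W ⊆ U, v ∉ clSet (low ++ [(entv, cv, v)]) W →
      TRa (clSet (low ++ [(entv, cv, v)]) W) = 0 ∧ TGa (clSet (low ++ [(entv, cv, v)]) W) = 0 := by
    intro W hW hvW
    have hlow : clSet (low ++ [(entv, cv, v)]) W ⊆ towerCore U low := by
      intro z hz
      rcases Finset.mem_insert.1 (hcl W hW hz) with h' | h'
      · exact absurd (h' ▸ hz) hvW
      · exact h'
    have hnoL : ∀ z ∈ up, ∀ r ∈ z.1, r ∉ clSet (low ++ [(entv, cv, v)]) W :=
      fun z hz r hr hrW => hcovL z hz r hr (hlow hrW)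
    have hno : ∀ r ∈ ent, r ∉ clSet (low ++ [(entv, cv, v)]) W :=
      fun r hr hrW => hcov r hr (hlow hrW)
    simp only [hTRa, hTGa]
    rw [towerVal_of_no_entry pr up FRa hnoL, towerVal_of_no_entry pr up FGa hnoL]
    simp only [hFRa, hFGa]
    exact ⟨rValKa_eq_zero_of_no_entry A pr c a hno, gValKa_eq_zero_of_no_entry A pr c a w hno⟩
  refine nested_weighted_nonneg U
    (fun W => prob pr (coreLevel arcs s U W) * TR (clSet (low ++ [(entv, cv, v)]) W))
    (fun W => prob pr (coreLevel arcs s U W) * TG (clSet (low ++ [(entv, cv, v)]) W))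
    (fun W => prob pr (coreLevel arcs s U W) * TRa (clSet (low ++ [(entv, cv, v)]) W))
    (fun W => prob pr (coreLevel arcs s U W) * TGa (clSet (low ++ [(entv, cv, v)]) W))
    (fun W => if v ∈ clSet (low ++ [(entv, cv, v)]) W then (1 : R) else 0)
    (fun W => mul_nonneg (hν0 W) (hTR0 _)) (fun W => mul_nonneg (hν0 W) (hTGa0 _))
    (fun W => mul_le_mul_of_nonneg_left (hTRale _) (hν0 W))
    (fun W => by rw [hTGeq]; ring) (fun W => by split_ifs <;> simp) ?_ ?_
  · intro W hW
    by_cases hvW : v ∈ clSet (low ++ [(entv, cv, v)]) W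
    · rw [if_pos hvW, one_mul]
    · rw [if_neg hvW, zero_mul, (hzero W (Finset.mem_powerset.1 hW) hvW).1, mul_zero]
  · intro W hW
    by_cases hvW : v ∈ clSet (low ++ [(entv, cv, v)]) W
    · rw [if_pos hvW, one_mul]
    · rw [if_neg hvW, zero_mul, (hzero W (Finset.mem_powerset.1 hW) hvW).2, mul_zero]

end TowerFunnelCoins

end Summit.Ventures.PercRepro2.Coin
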